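import Summits.MatrixMultiplication.MatrixMultiplication.Theorems.SoloBlindConjEReduction

/-!
# The binary lift: Conjecture E is attained with no small members (kernel witnesses, ranks 5 and 6)

Sub-programme (K₃) (Kraft inequality for zero-sum-free sequences over `𝔽₃`), H-good half.
CONJECTURE E says `soloBlindMass h S τ ≤ 1/2` whenever `h` is zero-sum free on `S` (exponent-`3` group) and
`τ` is H-good (`∑_T h ≠ τ + τ` for all `T ⊆ S`).  All inductive reductions proved so far (pair move, twin move,
triangle move, cone lift, cube-pair lemma) extract a SMALL member (size `≤ 3`) of the target.

THE BINARY LIFT `S_m = {a} ∪ {b_i, b_i + a : i ≤ m} ⊂ 𝔽₃^{m+1}` (`a, b_1, …, b_m` a basis) is zero-sum free, and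
the target `τ = c·a + ∑ b_i` with `m + c ≡ 1 (mod 3)` is H-good with Kraft mass EXACTLY `1/2`, while every one
of its representations has size `≥ m` (pen proof for all `m`: the representations are
`P ⊔ (Q + a) ⊔ ε{a}` with `P ⊔ Q = [m]`, `|Q| + ε ≡ c (mod 3)`, and the count uses
`#{Q : |Q| ≡ j (3)}` identities).  So Conjecture E is tight in every rank in a way invisible to every statement
about members of bounded size, and no proof can proceed by extracting bounded-size members and bounding the
remainder strictly.

This file certifies the witnesses of ranks `5` (`m = 4`, `c = 0`) and `6` (`m = 5`, `c = 2`) by kernel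
evaluation (`decide +kernel` over all `2^9`, resp. `2^11`, subsets):
* `soloBlind_conjE_tight_rank5` : a zero-sum-free `h : Fin 9 → (Fin 5 → ZMod 3)` and an H-good target all of
  whose representations have size `≥ 4` (pair-free, value-free, triangle-free), with mass exactly `1/2`;
* `soloBlind_conjE_tight_rank6` : the same in rank `6` with all representations of size `≥ 5`.
It also records the boundary example for the cross-Kraft inequality GE2
(`soloBlind_ge2_needs_empty_sum`): on the zero-sum-free set `{e₁, e₂, e₃, e₁+e₂, e₁+e₃, 2e₁+e₂+e₃} ⊂ 𝔽₃³` the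
targets `t = 2e₁+e₂+e₃` and `-t` have `K(t) + K(-t) = 5/4 > 1` although `t + (-t) = 0` is not a NON-EMPTY
subset sum — so 'K(t₁) + K(t₂) ≤ 1 whenever t₁ + t₂ ∉ Σ(S)' must read `Σ(S) ∪ {0}`.
-/

namespace Summit.MatrixMultiplication.MatrixMultiplication.Theorems

open Finset

/-! ## Rank 5: `S_4`, target `b₁ + b₂ + b₃ + b₄` -/

/-- The rank-5 binary lift `S_4 = {a} ∪ {b_i, a + b_i : i = 1..4}` in `𝔽₃⁵` as a table on `Fin 9`:
`0 ↦ a = e₀`, `i ↦ b_i = e_i` (`i = 1..4`), `4 + i ↦ a + b_i`. -/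
def soloBlindLiftFour : Fin 9 → (Fin 5 → ZMod 3) :=
  ![![1,0,0,0,0], ![0,1,0,0,0], ![0,0,1,0,0], ![0,0,0,1,0], ![0,0,0,0,1],
    ![1,1,0,0,0], ![1,0,1,0,0], ![1,0,0,1,0], ![1,0,0,0,1]]

/-- The rank-5 target `τ₄ = b₁ + b₂ + b₃ + b₄`. -/
def soloBlindLiftFourTarget : Fin 5 → ZMod 3 := ![0,1,1,1,1]

/-- `S_4` is zero-sum free. -/
theorem soloBlindLiftFour_zsf :
    ∀ T ⊆ (Finset.univ : Finset (Fin 9)), T.Nonempty → ∑ i ∈ T, soloBlindLiftFour i ≠ 0 := by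
  decide +kernel

/-- `τ₄` is H-good on `S_4`. -/
theorem soloBlindLiftFour_hgood :
    ∀ T ⊆ (Finset.univ : Finset (Fin 9)),
      ∑ i ∈ T, soloBlindLiftFour i ≠ soloBlindLiftFourTarget + soloBlindLiftFourTarget := by
  decide +kernel

/-- Every representation of `τ₄` on `S_4` has at least `4` elements (there are `5` of size `4` and `6` of
size `5`). -/
theorem soloBlindLiftFour_minsize :
    ∀ T ⊆ (Finset.univ : Finset (Fin 9)),
      ∑ i ∈ T, soloBlindLiftFour i = soloBlindLiftFourTarget → 4 ≤ T.card := by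
  decide +kernel

/-- The Kraft mass of `τ₄` on `S_4` is exactly `1/2` (`= 5/16 + 6/32`). -/
theorem soloBlindLiftFour_mass :
    soloBlindMass soloBlindLiftFour Finset.univ soloBlindLiftFourTarget = 1 / 2 := by
  decide +kernel

/-- CONJECTURE E IS TIGHT IN RANK 5 WITH NO MEMBER OF SIZE `≤ 3`: there are a zero-sum-free `h` on `Fin 9`
with values in `𝔽₃⁵` and an H-good target whose representations all have size `≥ 4` and whose Kraft mass is
exactly `1/2`. -/
theorem soloBlind_conjE_tight_rank5 :
    ∃ (h : Fin 9 → (Fin 5 → ZMod 3)) (τ : Fin 5 → ZMod 3),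
      (∀ T ⊆ (Finset.univ : Finset (Fin 9)), T.Nonempty → ∑ i ∈ T, h i ≠ 0) ∧
      (∀ T ⊆ (Finset.univ : Finset (Fin 9)), ∑ i ∈ T, h i ≠ τ + τ) ∧
      (∀ T ⊆ (Finset.univ : Finset (Fin 9)), ∑ i ∈ T, h i = τ → 4 ≤ T.card) ∧
      soloBlindMass h Finset.univ τ = 1 / 2 :=
  ⟨soloBlindLiftFour, soloBlindLiftFourTarget, soloBlindLiftFour_zsf, soloBlindLiftFour_hgood,
    soloBlindLiftFour_minsize, soloBlindLiftFour_mass⟩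

/-! ## Rank 6: `S_5`, target `2a + b₁ + ⋯ + b₅` -/

/-- The rank-6 binary lift `S_5` in `𝔽₃⁶` as a table on `Fin 11`: `0 ↦ a = e₀`, `i ↦ b_i = e_i` (`i = 1..5`),
`5 + i ↦ a + b_i`. -/
def soloBlindLiftFive : Fin 11 → (Fin 6 → ZMod 3) :=
  ![![1,0,0,0,0,0], ![0,1,0,0,0,0], ![0,0,1,0,0,0], ![0,0,0,1,0,0], ![0,0,0,0,1,0], ![0,0,0,0,0,1],
    ![1,1,0,0,0,0], ![1,0,1,0,0,0], ![1,0,0,1,0,0], ![1,0,0,0,1,0], ![1,0,0,0,0,1]]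

/-- The rank-6 target `2a + b₁ + b₂ + b₃ + b₄ + b₅` (`m + c = 5 + 2 ≡ 1 (mod 3)`). -/
def soloBlindLiftFiveTarget : Fin 6 → ZMod 3 := ![2,1,1,1,1,1]

/-- `S_5` is zero-sum free. -/
theorem soloBlindLiftFive_zsf :
    ∀ T ⊆ (Finset.univ : Finset (Fin 11)), T.Nonempty → ∑ i ∈ T, soloBlindLiftFive i ≠ 0 := by
  decide +kernel

/-- The rank-6 target is H-good on `S_5`. -/
theorem soloBlindLiftFive_hgood :
    ∀ T ⊆ (Finset.univ : Finset (Fin 11)),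
      ∑ i ∈ T, soloBlindLiftFive i ≠ soloBlindLiftFiveTarget + soloBlindLiftFiveTarget := by
  decide +kernel

/-- Every representation of the rank-6 target has at least `5` elements. -/
theorem soloBlindLiftFive_minsize :
    ∀ T ⊆ (Finset.univ : Finset (Fin 11)),
      ∑ i ∈ T, soloBlindLiftFive i = soloBlindLiftFiveTarget → 5 ≤ T.card := by
  decide +kernel

/-- The Kraft mass of the rank-6 target on `S_5` is exactly `1/2` (`= 11/32 + 10/64`). -/
theorem soloBlindLiftFive_mass :
    soloBlindMass soloBlindLiftFive Finset.univ soloBlindLiftFiveTarget = 1 / 2 := by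
  decide +kernel

/-- CONJECTURE E IS TIGHT IN RANK 6 WITH NO MEMBER OF SIZE `≤ 4`. -/
theorem soloBlind_conjE_tight_rank6 :
    ∃ (h : Fin 11 → (Fin 6 → ZMod 3)) (τ : Fin 6 → ZMod 3),
      (∀ T ⊆ (Finset.univ : Finset (Fin 11)), T.Nonempty → ∑ i ∈ T, h i ≠ 0) ∧
      (∀ T ⊆ (Finset.univ : Finset (Fin 11)), ∑ i ∈ T, h i ≠ τ + τ) ∧
      (∀ T ⊆ (Finset.univ : Finset (Fin 11)), ∑ i ∈ T, h i = τ → 5 ≤ T.card) ∧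
      soloBlindMass h Finset.univ τ = 1 / 2 :=
  ⟨soloBlindLiftFive, soloBlindLiftFiveTarget, soloBlindLiftFive_zsf, soloBlindLiftFive_hgood,
    soloBlindLiftFive_minsize, soloBlindLiftFive_mass⟩

/-! ## The cross-Kraft inequality needs the empty sum -/

/-- The zero-sum-free set `{e₁, e₂, e₃, e₁+e₂, e₁+e₃, 2e₁+e₂+e₃} ⊂ 𝔽₃³` as a table on `Fin 6`. -/
def soloBlindGE2Bdry : Fin 6 → (Fin 3 → ZMod 3) :=
  ![![1,0,0], ![0,1,0], ![0,0,1], ![1,1,0], ![1,0,1], ![2,1,1]]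

/-- The target `t = 2e₁ + e₂ + e₃`. -/
def soloBlindGE2BdryTarget : Fin 3 → ZMod 3 := ![2,1,1]

/-- The boundary set is zero-sum free (so `t + (-t) = 0` is not a non-empty subset sum). -/
theorem soloBlindGE2Bdry_zsf :
    ∀ T ⊆ (Finset.univ : Finset (Fin 6)), T.Nonempty → ∑ i ∈ T, soloBlindGE2Bdry i ≠ 0 := by
  decide +kernel

/-- GE2 NEEDS THE EMPTY SUM: `K(t) + K(-t) = 5/4 > 1` on the boundary set (`K(t) = 1/2 + 1/4 + 1/4`,
`K(-t) = 1/4`), although `t + (-t) ∉ Σ(S)`; the correct hypothesis of the cross-Kraft inequality is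
`t₁ + t₂ ∉ Σ(S) ∪ {0}`. -/
theorem soloBlind_ge2_needs_empty_sum :
    soloBlindMass soloBlindGE2Bdry Finset.univ soloBlindGE2BdryTarget +
      soloBlindMass soloBlindGE2Bdry Finset.univ (-soloBlindGE2BdryTarget) = 5 / 4 := by
  decide +kernel

end Summit.MatrixMultiplication.MatrixMultiplication.Theorems
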